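import Mathlib.NumberTheory.Padics.RingHoms
import Mathlib.Topology.Algebra.OpenSubgroup
import Literature.IUT.LogVolume.LogShellTopology
import HarnessLib

/-!
# Compact subgroups of `ℤ_l^×` are open or finite

For a prime `l`, a compact (equivalently, closed) subgroup `H` of the unit group `ℤ_l^×` of the
`l`-adic integers is either OPEN or FINITE (`isOpen_or_finite_of_isCompact_subgroup_units`).
Classically this is read off from the structure `ℤ_l^× ≅ μ × (1 + l^ε ℤ_l) ≅ μ × ℤ_l` (Neukirch,
*Algebraic Number Theory*, Ch. II, (5.3)–(5.7): the closed subgroups of `ℤ_l` are `0` and the open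
`l^n ℤ_l`).  We avoid the exponential and argue directly with the `l`-adic LOGARITHM of the tree
(`Literature.IUT.LogVolume.unitLog` on the unit sphere of `K = ℚ_l`, campaign-S seat abc-iut-S1:
a continuous homomorphism, `unitLog_mul`, `continuousOn_unitLog`, which on the principal units
`{‖1 − u‖ ≤ l⁻²}` is the logarithmic series and maps `{‖1 − u‖ ≤ ρ}` BIJECTIVELY onto `{‖z‖ ≤ ρ}`
for every `ρ ≤ l⁻²`, `logSeries_image_closedBall` / `logSeries_injOn`, Koblitz Ch. IV §2):

* if `H` meets the principal units `U = {u : ‖1 − u‖ ≤ l⁻²}` only in `1`, then `H` is discrete in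
  its (compact) subspace topology, hence finite;
* if `1 ≠ h ∈ H ∩ U`, then `A := log(H ∩ U)` is a compact, hence closed, additive subgroup of `ℚ_l`
  containing `log h ≠ 0`; closed additive subgroups of `ℚ_l` are `ℤ_l`-modules (`ℕ` is dense in
  `ℤ_l`), so `A ⊇ ℤ_l · log h ⊇ {‖z‖ ≤ ‖log h‖}`, and pulling back through the bijection `log` shows
  `H ⊇ {u : ‖1 − u‖ ≤ ‖log h‖}`, a neighbourhood of `1`; a subgroup containing a neighbourhood of `1`
  is open.

Used by `Literature/AnabelianGeometry/AbsoluteAnabelian/AbsTopIII/KummerFaithfulCyclotomicProofs`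
([AbsTopIII] Rmk. 1.5.1: open image of the cyclotomic character of a torally Kummer-faithful
field).  Theorems only; no new definitions.
-/

noncomputable section

open Metric Set Filter
open scoped Topology

namespace Literature.NumberTheory.GaloisRepresentations

open Literature.IUT.LogVolume IsUltrametricDist

variable (l : ℕ) [Fact l.Prime]

/-- The unit `u ∈ ℤ_l^×` seen in `ℚ_l` has norm `1`. [cite: NeukirchANT1999, Ch. II (5.3)] -/
private theorem norm_coe_units (u : ℤ_[l]ˣ) : ‖((u : ℤ_[l]) : ℚ_[l])‖ = 1 := by
  rw [← PadicInt.norm_def]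
  exact PadicInt.norm_units u

/-- `ℤ_l^× → ℚ_l` is continuous. [cite: NeukirchANT1999, Ch. II (5.3)] -/
private theorem continuous_coe_units : Continuous fun u : ℤ_[l]ˣ ↦ ((u : ℤ_[l]) : ℚ_[l]) := by
  have h : Continuous ((↑) : ℤ_[l]ˣ → ℤ_[l]) := Units.continuous_val
  exact continuous_subtype_val.comp h

/-- `ℤ_l^× → ℚ_l` is injective. [cite: NeukirchANT1999, Ch. II (5.3)] -/
private theorem coe_units_injective : Function.Injective fun u : ℤ_[l]ˣ ↦ ((u : ℤ_[l]) : ℚ_[l]) :=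
  fun _ _ h ↦ Units.ext (Subtype.ext h)

/-- Principal units of level `r < 1` are closed under products: `‖1 − xy‖ ≤ max (‖1 − x‖, ‖1 − y‖)`
for `‖x‖ = 1`. [cite: NeukirchANT1999, Ch. II (5.3)] -/
private theorem norm_one_sub_mul_le {x y : ℚ_[l]} (hx : ‖x‖ = 1) {r : ℝ} (h₁ : ‖1 - x‖ ≤ r)
    (h₂ : ‖1 - y‖ ≤ r) : ‖1 - x * y‖ ≤ r := by
  have e : 1 - x * y = (1 - x) + x * (1 - y) := by ring
  rw [e]
  refine (norm_add_le_max _ _).trans (max_le h₁ ?_)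
  rw [norm_mul, hx, one_mul]
  exact h₂

/-- Principal units of level `r` are closed under inverses. [cite: NeukirchANT1999, Ch. II (5.3)] -/
private theorem norm_one_sub_inv_le {x : ℚ_[l]} (hx : ‖x‖ = 1) {r : ℝ} (h : ‖1 - x‖ ≤ r) :
    ‖1 - x⁻¹‖ ≤ r := by
  have hx0 : x ≠ 0 := norm_pos_iff.1 (by rw [hx]; exact one_pos)
  have e : 1 - x⁻¹ = -(x⁻¹ * (1 - x)) := by field_simp; ring
  rw [e, norm_neg, norm_mul, norm_inv, hx, inv_one, one_mul]
  exact h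

/-- In `ℚ_l`, a CLOSED additive subgroup is a `ℤ_l`-submodule: it is stable under multiplication
by `l`-adic integers (`ℕ` is dense in `ℤ_l`). [cite: NeukirchANT1999, Ch. II (5.3)] -/
private theorem mul_mem_of_isClosed_addSubgroup (A : AddSubgroup ℚ_[l]) (hA : IsClosed (A : Set ℚ_[l]))
    {z : ℚ_[l]} (hz : z ∈ A) (c : ℤ_[l]) : (c : ℚ_[l]) * z ∈ A := by
  have hnat : ∀ n : ℕ, ((n : ℤ_[l]) : ℚ_[l]) * z ∈ (A : Set ℚ_[l]) := fun n ↦ by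
    rw [PadicInt.coe_natCast, ← nsmul_eq_mul]
    exact A.nsmul_mem hz n
  have hcont : Continuous fun c : ℤ_[l] ↦ (c : ℚ_[l]) * z :=
    continuous_subtype_val.mul continuous_const
  have hmem : (c : ℚ_[l]) * z ∈ closure (A : Set ℚ_[l]) := by
    have hc : c ∈ closure (Set.range (Nat.cast : ℕ → ℤ_[l])) :=
      (PadicInt.denseRange_natCast (p := l)).closure_range ▸ Set.mem_univ c
    have h1 := image_closure_subset_closure_image hcont (Set.mem_image_of_mem _ hc)
    refine closure_mono ?_ h1
    rintro _ ⟨_, ⟨n, rfl⟩, rfl⟩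
    exact hnat n
  rwa [hA.closure_eq] at hmem

/-- **A compact subgroup of `ℤ_l^×` meeting the principal units `{‖1 − u‖ ≤ l⁻²}` trivially is
finite** (it is discrete in its compact subspace topology). [cite: NeukirchANT1999, Ch. II (5.7)] -/
theorem finite_of_isCompact_subgroup_units (H : Subgroup ℤ_[l]ˣ) (hH : IsCompact (H : Set ℤ_[l]ˣ))
    (htriv : ∀ u ∈ H, ‖1 - ((u : ℤ_[l]) : ℚ_[l])‖ ≤ (l : ℝ) ^ (-(2 : ℝ)) → u = 1) :
    (H : Set ℤ_[l]ˣ).Finite := by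
  have hl0 : (0 : ℝ) < (l : ℝ) ^ (-(2 : ℝ)) :=
    Real.rpow_pos_of_pos (by exact_mod_cast (Fact.out : l.Prime).pos) _
  -- the open neighbourhood `V = {u : ‖1 - u‖ ≤ l⁻²}` of `1` in `ℤ_l^×`
  set V : Set ℤ_[l]ˣ := {u | ‖1 - ((u : ℤ_[l]) : ℚ_[l])‖ ≤ (l : ℝ) ^ (-(2 : ℝ))} with hV
  have hVopen : IsOpen V := by
    have : V = (fun u : ℤ_[l]ˣ ↦ ((u : ℤ_[l]) : ℚ_[l])) ⁻¹' closedBall (1 : ℚ_[l]) ((l : ℝ) ^ (-(2 : ℝ))) := by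
      ext u
      simp [hV, mem_closedBall, dist_eq_norm, norm_sub_rev]
    rw [this]
    exact (IsUltrametricDist.isOpen_closedBall (1 : ℚ_[l]) hl0.ne').preimage (continuous_coe_units l)
  have h1V : (1 : ℤ_[l]ˣ) ∈ V := by
    change ‖(1 : ℚ_[l]) - (((1 : ℤ_[l]ˣ) : ℤ_[l]) : ℚ_[l])‖ ≤ _
    simp only [Units.val_one, PadicInt.coe_one, sub_self, norm_zero]
    exact hl0.le
  -- cover `H` by the translates `h • V`, each meeting `H` in `{h}` only
  have hcover : (H : Set ℤ_[l]ˣ) ⊆ ⋃ h : H, (fun v ↦ (h : ℤ_[l]ˣ) * v) '' V := by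
    intro h hh
    exact Set.mem_iUnion.2 ⟨⟨h, hh⟩, 1, h1V, mul_one h⟩
  have hopen : ∀ h : H, IsOpen ((fun v ↦ (h : ℤ_[l]ˣ) * v) '' V) := fun h ↦
    (Homeomorph.mulLeft (h : ℤ_[l]ˣ)).isOpenMap V hVopen
  obtain ⟨t, ht⟩ := hH.elim_finite_subcover _ hopen hcover
  refine (t.finite_toSet.image fun h : H ↦ (h : ℤ_[l]ˣ)).subset fun h hh ↦ ?_
  obtain ⟨i, hi, v, hv, hiv⟩ : ∃ i ∈ t, ∃ v ∈ V, (i : ℤ_[l]ˣ) * v = h := by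
    have := ht hh
    simp only [Set.mem_iUnion, Set.mem_image] at this
    obtain ⟨i, hi, v, hv, e⟩ := this
    exact ⟨i, hi, v, hv, e⟩
  have hvH : v ∈ H := by
    have : v = (i : ℤ_[l]ˣ)⁻¹ * h := by rw [← hiv, inv_mul_cancel_left]
    rw [this]
    exact H.mul_mem (H.inv_mem i.2) hh
  have hv1 : v = 1 := htriv v hvH hv
  refine ⟨i, Finset.mem_coe.2 hi, ?_⟩
  rw [← hiv, hv1, mul_one]

/-- **A compact subgroup of `ℤ_l^×` containing a principal unit `h ≠ 1` with `‖1 − h‖ ≤ l⁻²` is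
open**: the `l`-adic logarithm carries `H ∩ {‖1 − u‖ ≤ l⁻²}` onto a closed, `ℤ_l`-stable additive
subgroup of `ℚ_l` containing `log h ≠ 0`, hence containing the ball `{‖z‖ ≤ ‖log h‖}`, whose
preimage `{u : ‖1 − u‖ ≤ ‖log h‖}` is a neighbourhood of `1` inside `H`.
[cite: NeukirchANT1999, Ch. II (5.5)] -/
theorem isOpen_of_isCompact_subgroup_units (H : Subgroup ℤ_[l]ˣ) (hH : IsCompact (H : Set ℤ_[l]ˣ))
    {h : ℤ_[l]ˣ} (hhH : h ∈ H) (hh1 : h ≠ 1)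
    (hhr : ‖1 - ((h : ℤ_[l]) : ℚ_[l])‖ ≤ (l : ℝ) ^ (-(2 : ℝ))) : IsOpen (H : Set ℤ_[l]ˣ) := by
  have hl : l.Prime := Fact.out
  set r : ℝ := (l : ℝ) ^ (-(2 : ℝ)) with hr
  have hr0 : 0 < r := Real.rpow_pos_of_pos (by exact_mod_cast hl.pos) _
  have hr1 : r < 1 := Real.rpow_lt_one_of_one_lt_of_neg (by exact_mod_cast hl.one_lt) (by norm_num)
  have hθ : r * (l : ℝ) ^ (1 / ((l : ℝ) - 1)) < 1 := rpow_neg_two_mul_lt_one l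
  -- notation
  let ι : ℤ_[l]ˣ → ℚ_[l] := fun u ↦ ((u : ℤ_[l]) : ℚ_[l])
  have hι1 : ∀ u, ‖ι u‖ = 1 := norm_coe_units l
  have hιmul : ∀ u v, ι (u * v) = ι u * ι v := fun u v ↦ by
    simp [ι, Units.val_mul, PadicInt.coe_mul]
  have hιone : ι 1 = 1 := by simp [ι]
  -- the logarithm on the principal units of level `r`
  have hlog_eq : ∀ y : ℚ_[l], ‖1 - y‖ ≤ r → unitLog y = logSeries y := fun y hy ↦
    unitLog_of_isPrincipal l (lt_of_le_of_lt hy hr1)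
  have hlog_norm : ∀ y : ℚ_[l], ‖1 - y‖ ≤ r → ‖unitLog y‖ ≤ ‖1 - y‖ := fun y hy ↦ by
    rw [hlog_eq y hy]
    exact norm_logSeries_le_norm l ℚ_[l] hθ.le hy
  have hlog_inj : ∀ y₁ y₂ : ℚ_[l], ‖1 - y₁‖ ≤ r → ‖1 - y₂‖ ≤ r →
      unitLog y₁ = unitLog y₂ → y₁ = y₂ := fun y₁ y₂ h₁ h₂ h ↦ by
    rw [hlog_eq y₁ h₁, hlog_eq y₂ h₂] at h
    exact logSeries_injOn l ℚ_[l] hθ h₁ h₂ h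
  -- `S = H ∩ {‖1 - u‖ ≤ r}` and its image `A = log S`, a closed additive subgroup of `ℚ_l`
  set S : Set ℤ_[l]ˣ := {u | u ∈ H ∧ ‖1 - ι u‖ ≤ r} with hS
  have hSclosed : IsClosed S := by
    have h1 : IsClosed {u : ℤ_[l]ˣ | ‖1 - ι u‖ ≤ r} :=
      isClosed_le (continuous_const.sub (continuous_coe_units l)).norm continuous_const
    exact (hH.isClosed.inter h1)
  have hScpt : IsCompact S := hH.of_isClosed_subset hSclosed fun u hu ↦ hu.1
  let A : AddSubgroup ℚ_[l] :=
    { carrier := (unitLog ∘ ι) '' S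
      zero_mem' := ⟨1, ⟨H.one_mem, by simp [hιone, hr0.le]⟩, by simp [ι, unitLog_one l]⟩
      add_mem' := by
        rintro _ _ ⟨u, ⟨huH, hur⟩, rfl⟩ ⟨v, ⟨hvH, hvr⟩, rfl⟩
        refine ⟨u * v, ⟨H.mul_mem huH hvH, ?_⟩, ?_⟩
        · rw [hιmul]
          exact norm_one_sub_mul_le l (hι1 u) hur hvr
        · simp only [Function.comp_apply, hιmul]
          exact unitLog_mul l (hι1 u) (hι1 v)
      neg_mem' := by
        rintro _ ⟨u, ⟨huH, hur⟩, rfl⟩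
        refine ⟨u⁻¹, ⟨H.inv_mem huH, ?_⟩, ?_⟩
        · have : ι u⁻¹ = (ι u)⁻¹ :=
            eq_inv_of_mul_eq_one_right (by rw [← hιmul, mul_inv_cancel, hιone])
          rw [this]
          exact norm_one_sub_inv_le l (hι1 u) hur
        · have : ι u⁻¹ = (ι u)⁻¹ :=
            eq_inv_of_mul_eq_one_right (by rw [← hιmul, mul_inv_cancel, hιone])
          simp only [Function.comp_apply, this]
          exact unitLog_inv l (hι1 u) }
  have hAclosed : IsClosed (A : Set ℚ_[l]) := by
    change IsClosed ((unitLog ∘ ι) '' S)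
    refine IsCompact.isClosed ?_
    rw [Set.image_comp]
    refine (hScpt.image (continuous_coe_units l)).image_of_continuousOn
      ((continuousOn_unitLog l ℚ_[l]).mono ?_)
    rintro _ ⟨u, -, rfl⟩
    exact hι1 u
  -- `z₀ = log h ≠ 0`, `ρ := ‖z₀‖ ≤ r`
  set z₀ : ℚ_[l] := unitLog (ι h) with hz₀
  have hz₀A : z₀ ∈ A := ⟨h, ⟨hhH, hhr⟩, rfl⟩
  have hz₀0 : z₀ ≠ 0 := by
    intro h0
    apply hh1
    apply coe_units_injective l
    change ι h = ι 1
    rw [hιone]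
    refine hlog_inj _ _ hhr (by simp [hr0.le]) ?_
    rw [← hz₀, h0, unitLog_one l]
  set ρ : ℝ := ‖z₀‖ with hρ
  have hρ0 : 0 < ρ := norm_pos_iff.2 hz₀0
  have hρr : ρ ≤ r := (hlog_norm _ hhr).trans hhr
  -- `A ⊇ {‖z‖ ≤ ρ}`
  have hball : ∀ w : ℚ_[l], ‖w‖ ≤ ρ → w ∈ A := by
    intro w hw
    have hc : ‖w / z₀‖ ≤ 1 := by
      rw [norm_div, div_le_one hρ0]
      exact hw
    have := mul_mem_of_isClosed_addSubgroup l A hAclosed hz₀A ⟨w / z₀, hc⟩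
    simpa [div_mul_cancel₀ w hz₀0] using this
  -- hence `H ⊇ {u : ‖1 - u‖ ≤ ρ}`, a neighbourhood of `1`
  have hnhds : ∀ u : ℤ_[l]ˣ, ‖1 - ι u‖ ≤ ρ → u ∈ H := by
    intro u hu
    have hur : ‖1 - ι u‖ ≤ r := hu.trans hρr
    have hlu : unitLog (ι u) ∈ A := hball _ ((hlog_norm _ hur).trans hu)
    obtain ⟨v, ⟨hvH, hvr⟩, hv⟩ := hlu
    have : v = u := coe_units_injective l (hlog_inj _ _ hvr hur hv)
    exact this ▸ hvH
  refine H.isOpen_of_mem_nhds (g := 1) ?_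
  have hW : IsOpen {u : ℤ_[l]ˣ | ‖1 - ι u‖ ≤ ρ} := by
    have : {u : ℤ_[l]ˣ | ‖1 - ι u‖ ≤ ρ} = ι ⁻¹' closedBall (1 : ℚ_[l]) ρ := by
      ext u
      simp [mem_closedBall, dist_eq_norm, norm_sub_rev]
    rw [this]
    exact (IsUltrametricDist.isOpen_closedBall (1 : ℚ_[l]) hρ0.ne').preimage
      (continuous_coe_units l)
  exact Filter.mem_of_superset (hW.mem_nhds (by simp [hιone, hρ0.le])) fun u hu ↦ hnhds u hu

/-- **Compact subgroups of `ℤ_l^×` are open or finite** (the dichotomy for closed subgroups of the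
one-dimensional `l`-adic Lie group `ℤ_l^× ≅ μ × ℤ_l`). [cite: NeukirchANT1999, Ch. II (5.7)] -/
theorem isOpen_or_finite_of_isCompact_subgroup_units (H : Subgroup ℤ_[l]ˣ)
    (hH : IsCompact (H : Set ℤ_[l]ˣ)) : IsOpen (H : Set ℤ_[l]ˣ) ∨ (H : Set ℤ_[l]ˣ).Finite := by
  by_cases htriv : ∀ u ∈ H, ‖1 - ((u : ℤ_[l]) : ℚ_[l])‖ ≤ (l : ℝ) ^ (-(2 : ℝ)) → u = 1
  · exact Or.inr (finite_of_isCompact_subgroup_units l H hH htriv)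
  · push Not at htriv
    obtain ⟨h, hhH, hhr, hh1⟩ := htriv
    exact Or.inl (isOpen_of_isCompact_subgroup_units l H hH hhH hh1 hhr)

end Literature.NumberTheory.GaloisRepresentations
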